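import Literature.Analysis.FluidPDE.RieszPressureSpaceTime
import Mathlib.MeasureTheory.Function.ContinuousMapDense
import HarnessLib

/-!
# The Riesz pressure of an `L³((0,S) × ℝ³)` velocity: a jointly measurable space–time representative

Analysis/FluidPDE proof file (theorems only) on the discharge path of the named fact
`Literature.Analysis.FluidPDE.ess_associated_pressure` (`NSSuitableESS.lean`; Escauriaza–Seregin–
Šverák 2003, §3, (3.2)–(3.4): the associated pressure `p ∈ L_{3/2,∞}(Q_T)` of an `L_{3,∞}`
Leray–Hopf solution, "using known Ladyzhenskaya's arguments"). The pressure is the Riesz pressure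
`p(t) = Σᵢⱼ ℛᵢℛⱼ(uᵢuⱼ)(t)` of the slices; the tree has the slice operator
`Π = rieszPressure : L³ → L^{3/2}` (`RieszPressureL3.lean`, from the proved Calderón–Zygmund bound
`stein1970_normalisedPressure_Lp_bound_holds`) and the jointly measurable space–time representative
of `t ↦ Π[u(t)]` **along an `L³`-continuous curve** (`RieszPressureSpaceTime.lean`,
`exists_stronglyMeasurable_slice_ae_eq_rieszPressure`, the Kato class `C([0,S]; L³)`). A Leray–Hopf
solution in `L^∞(0,T; L³)` is not known to be `L³`-continuous in time, so this file removes the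
continuity hypothesis: it suffices that `u` be jointly measurable with `u ∈ L³((0,S) × ℝ³)`.

* `continuousInLpOn_curry_of_hasCompactSupport` — a continuous compactly supported space–time field
  is an `L³`-continuous curve (uniform continuity);
* `exists_hasCompactSupport_eLpNorm_sub_le_slab` — `C_c(ℝ × ℝ³)` is dense in `L³` of the slab
  (Mathlib's `MemLp.exists_hasCompactSupport_eLpNorm_sub_le` on the zero extension), with rate `2⁻ʲ`;
* `ae_memLp_slice_of_memLp_slab` — a.e. slice of an `L³` field of the slab is in `L³` (Tonelli);
* `lintegral_eLpNorm_rieszPressure_sub_rpow_le` — the bilinear estimate of `Π`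
  (`eLpNorm_rieszPressure_sub_le`, Tsai 1998, Lemma 2.1) integrated in time:
  `∫₀ˢ ‖Π[v(t)] - Π[w(t)]‖_{3/2}^{3/2} dt ≤ K ((τ²)^{3/2} ∫∫|v - w|³ + (τ⁻²)^{3/2} ∫∫|v + w|³)` for every
  `τ > 0`;
* `exists_forall_lintegral_eLpNorm_rieszPressure_sub_rpow_le` — hence `‖wⱼ - u‖_{L³(slab)} ≤ 2⁻ʲ`
  makes `∫₀ˢ ‖Π[wₙ(t)] - Π[wₘ(t)]‖_{3/2}^{3/2} dt` small for large `n, m` (no time measurability of the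
  slice pressures of `u` is needed: only pairs of approximants are compared);
* `ae_tendsto_eLpNorm_slice_sub` — and `wⱼ(t) → u(t)` in `L³` for a.e. `t` (Tonelli and
  `∑ ∫ < ∞`);
* `exists_aestronglyMeasurable_slice_ae_eq_rieszPressure_of_memLp` — **the representative**: for
  `u ∈ L³((0,S) × ℝ³)` there is `P`, a.e. strongly measurable and in `L^{3/2}` on the slab, with
  `P(t, ·) = Π[u(t)]` a.e., for a.e. `t ∈ (0,S)` (approximate `u` by `wⱼ ∈ C_c`; the space–time
  pressures of the continuous curves `wⱼ` (`exists_spaceTime_rieszPressure`) are Cauchy in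
  `L^{3/2}` of the slab, converge in `L^{3/2}` and a.e. along a subsequence; the slices of the limit
  are identified with `Π[u(t)]` by the continuity of `Π` on `L³` and convergence in measure);
* `exists_spaceTime_rieszPressure_of_memLp` — the pressure with its classes: jointly measurable,
  in `L^{3/2}((0,S) × ℝ³)`, slices `p(t) = Π[u(t)] ∈ L^{3/2}` with Stein's bound
  `‖p(t)‖_{3/2} ≤ C_{3/2}‖u(t)‖₃²` and the weak Poisson equation `∫ p(t) Δφ = -∫ D²φ(u(t), u(t))`,
  for a.e. `t` — the "associated pressure" of ESS (3.2)–(3.4) for velocities without time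
  regularity.

## Mathlib / tree search

Tree (all used): `rieszPressure`, `memLp_rieszPressure`, `eLpNorm_rieszPressure_le`,
`eLpNorm_rieszPressure_sub_le`, `rieszPressure_congr_ae`, `aestronglyMeasurable_rieszPressure'`,
`integral_rieszPressure_mul_laplacian`, `steinConstThreeHalves` (`RieszPressureL3.lean`);
`exists_stronglyMeasurable_slice_ae_eq_rieszPressure`, `ContinuousInLpOn` (`RieszPressureSpaceTime`,
`LerayHopf`). `lean search 'continuousInLpOn_.*ompactSupport|exists_hasCompactSupport.*slab'`: nothing
for space–time fields. Mathlib: `MemLp.exists_hasCompactSupport_eLpNorm_sub_le`,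
`HasCompactSupport.uniformContinuous_of_continuous`, `eLpNorm_indicator_const`,
`AEStronglyMeasurable.prodMk_left`, `Measure.ae_ae_of_ae_prod`, `Measure.restrict_prod_eq_prod_univ`,
`Lp.cauchySeq_Lp_iff_cauchySeq_eLpNorm`, `cauchySeq_tendsto_of_complete`,
`Lp.tendsto_Lp_iff_tendsto_eLpNorm'`, `tendstoInMeasure_of_tendsto_eLpNorm`,
`TendstoInMeasure.exists_seq_tendsto_ae`, `lintegral_prod`, `lintegral_tsum`, `ae_lt_top'`,
`ENNReal.tendsto_atTop_zero_of_tsum_ne_top`, `ENNReal.rpow_add_le_mul_rpow_add_rpow`.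

## References

* L. Escauriaza, G. Seregin, V. Šverák, *`L_{3,∞}`-solutions of Navier–Stokes equations and
  backward uniqueness*, Russ. Math. Surveys 58:2 (2003) 211–250, §3 (3.2)–(3.4).
  [EscauriazaSereginSverak2003]
* T.-P. Tsai, Arch. Rational Mech. Anal. 143 (1998), Lemma 2.1 and its proof (p. 34). [Tsai1998]
* E. M. Stein, *Singular integrals and differentiability properties of functions* (1970), Ch. II
  §4.2 Thm. 3. [Stein1971]
* P. G. Lemarié-Rieusset, *The Navier–Stokes Problem in the 21st Century* (2016), Prop. 6.5 with
  Def. 6.9 (the pressure of an `L^∞_t L³_x` very weak solution). [LemarieRieusset2016]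
-/

noncomputable section

open MeasureTheory TopologicalSpace Set Function Filter Topology Metric
open scoped ENNReal NNReal RealInnerProductSpace Laplacian

namespace Literature.Analysis.FluidPDE

/-- Local notation for physical space `ℝ³ = EuclideanSpace ℝ (Fin 3)`. -/
local notation "ℝ³" => EuclideanSpace ℝ (Fin 3)

/-! ### Continuous compactly supported space–time fields are `L³`-continuous curves -/

section Curve

variable {F : Type*} [NormedAddCommGroup F]

/-- The slices of a compactly supported space–time field vanish off the projection of the
support. [folklore] -/
theorem apply_eq_zero_of_notMem_snd_image_tsupport {w : ℝ × ℝ³ → F} (t : ℝ) {x : ℝ³}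
    (hx : x ∉ Prod.snd '' tsupport w) : w (t, x) = 0 := by
  by_contra h
  exact hx ⟨(t, x), subset_tsupport _ h, rfl⟩

/-- The slices of a continuous compactly supported space–time field are continuous with compact
support. [folklore] -/
theorem hasCompactSupport_slice {w : ℝ × ℝ³ → F} (hwc : HasCompactSupport w) (t : ℝ) :
    HasCompactSupport fun x => w (t, x) :=
  HasCompactSupport.intro (hwc.isCompact.image continuous_snd) fun _ hx =>
    apply_eq_zero_of_notMem_snd_image_tsupport t hx

/-- **A continuous compactly supported space–time field is an `L³`-continuous curve** on every
time set: `‖w(t) - w(t₀)‖_{L³} ≤ ω(|t - t₀|) |K|^{1/3}` with `ω` the modulus of uniform continuity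
and `K` the spatial projection of the support. [folklore] -/
theorem continuousInLpOn_curry_of_hasCompactSupport {w : ℝ × ℝ³ → F} (hw : Continuous w)
    (hwc : HasCompactSupport w) (I : Set ℝ) :
    ContinuousInLpOn I 3 (curry w) := by
  set K : Set ℝ³ := Prod.snd '' tsupport w with hK
  have hKc : IsCompact K := hwc.isCompact.image continuous_snd
  have hKm : MeasurableSet K := hKc.isClosed.measurableSet
  have hKfin : volume K < ⊤ := hKc.measure_lt_top
  have hslice : ∀ t, Continuous fun x => w (t, x) := fun t =>
    hw.comp (continuous_const.prodMk continuous_id)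
  refine ⟨fun t _ => (hslice t).memLp_of_hasCompactSupport (hasCompactSupport_slice hwc t), ?_⟩
  intro t₀ _
  have hU : UniformContinuous w := hwc.uniformContinuous_of_continuous hw
  rw [Metric.uniformContinuous_iff] at hU
  set c : ℝ≥0∞ := volume K ^ (1 / (3 : ℝ≥0∞).toReal) with hc
  have hctop : c ≠ ⊤ := ENNReal.rpow_ne_top_of_nonneg (by norm_num) hKfin.ne
  refine ENNReal.tendsto_nhds_zero.2 fun ε hε => ?_
  -- choose the height `η` with `η |K|^{1/3} < ε`
  obtain ⟨η, hη, hηε⟩ : ∃ η : ℝ≥0, 0 < η ∧ (η : ℝ≥0∞) * c < ε :=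
    ENNReal.exists_nnreal_pos_mul_lt hctop hε.ne'
  obtain ⟨δ, hδ, hδ'⟩ := hU η (by exact_mod_cast hη)
  have hev : ∀ᶠ t in 𝓝[I] t₀, dist t t₀ < δ :=
    mem_nhdsWithin_of_mem_nhds (Metric.ball_mem_nhds t₀ hδ)
  filter_upwards [hev] with t ht
  -- pointwise bound by the indicator of `K`
  have hpt : ∀ x, ‖(curry w t - curry w t₀) x‖ ≤ ‖K.indicator (fun _ => ((η : ℝ≥0) : ℝ)) x‖ := by
    intro x
    by_cases hx : x ∈ K
    · rw [indicator_of_mem hx, Real.norm_eq_abs, abs_of_nonneg η.coe_nonneg]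
      have h := hδ' (a := (t, x)) (b := (t₀, x)) (by
        rw [Prod.dist_eq, dist_self, max_eq_left dist_nonneg]; exact ht)
      rw [dist_eq_norm] at h
      exact h.le
    · rw [indicator_of_notMem hx, norm_zero]
      simp only [Pi.sub_apply, curry_apply, apply_eq_zero_of_notMem_snd_image_tsupport t hx,
        apply_eq_zero_of_notMem_snd_image_tsupport t₀ hx, sub_zero, norm_zero, le_refl]
  calc eLpNorm (curry w t - curry w t₀) 3 volume
      ≤ eLpNorm (K.indicator fun _ => ((η : ℝ≥0) : ℝ)) 3 volume := eLpNorm_mono hpt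
    _ = ‖((η : ℝ≥0) : ℝ)‖ₑ * c := by
        rw [eLpNorm_indicator_const hKm (by norm_num) (by norm_num), hc]
    _ = (η : ℝ≥0∞) * c := by
        rw [Real.enorm_eq_ofReal η.coe_nonneg, ENNReal.ofReal_coe_nnreal]
    _ ≤ ε := hηε.le

end Curve

/-! ### `C_c(ℝ × ℝ³)` is dense in `L³` of the slab -/

section Density

variable {F : Type*} [NormedAddCommGroup F] [NormedSpace ℝ F]

/-- **Density of `C_c(ℝ × ℝ³)` in `L³((0,S) × ℝ³)` with geometric rate**: for `U ∈ L³` of the slab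
there are continuous compactly supported space–time fields `wⱼ` with
`‖wⱼ - U‖_{L³((0,S)×ℝ³)} ≤ 2⁻ʲ` (Mathlib's density theorem applied to the zero extension of `U`,
then restricted back to the slab). [folklore] -/
theorem exists_hasCompactSupport_eLpNorm_sub_le_slab {S : ℝ} {U : ℝ × ℝ³ → F}
    (hU : MemLp U 3 (volume.restrict (Ioo 0 S ×ˢ (univ : Set ℝ³)))) :
    ∃ w : ℕ → ℝ × ℝ³ → F, (∀ j, Continuous (w j) ∧ HasCompactSupport (w j)) ∧
      ∀ j, eLpNorm (w j - U) 3 (volume.restrict (Ioo 0 S ×ˢ (univ : Set ℝ³))) ≤ (2⁻¹ : ℝ≥0∞) ^ j := by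
  set s : Set (ℝ × ℝ³) := Ioo 0 S ×ˢ (univ : Set ℝ³) with hs_def
  have hs : MeasurableSet s := measurableSet_Ioo.prod MeasurableSet.univ
  -- the zero extension is in `L³(ℝ × ℝ³)`
  have hF : MemLp (s.indicator U) 3 (volume : Measure (ℝ × ℝ³)) :=
    (memLp_indicator_iff_restrict hs).2 hU
  have key : ∀ j : ℕ, ∃ g : ℝ × ℝ³ → F, HasCompactSupport g ∧
      eLpNorm (s.indicator U - g) 3 volume ≤ (2⁻¹ : ℝ≥0∞) ^ j ∧ Continuous g ∧ MemLp g 3 volume :=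
    fun j => hF.exists_hasCompactSupport_eLpNorm_sub_le ENNReal.ofNat_ne_top
      (pow_ne_zero _ (ENNReal.inv_ne_zero.2 ENNReal.ofNat_ne_top))
  choose w hwc hwε hwcont _ using key
  refine ⟨w, fun j => ⟨hwcont j, hwc j⟩, fun j => ?_⟩
  have hae : w j - U =ᵐ[volume.restrict s] w j - s.indicator U := by
    filter_upwards [ae_restrict_mem hs] with z hz
    simp only [Pi.sub_apply, indicator_of_mem hz]
  calc eLpNorm (w j - U) 3 (volume.restrict s)
      = eLpNorm (w j - s.indicator U) 3 (volume.restrict s) := eLpNorm_congr_ae hae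
    _ ≤ eLpNorm (w j - s.indicator U) 3 volume := eLpNorm_mono_measure _ Measure.restrict_le_self
    _ = eLpNorm (s.indicator U - w j) 3 volume := eLpNorm_sub_comm _ _ _ _
    _ ≤ (2⁻¹ : ℝ≥0∞) ^ j := hwε j

end Density

/-! ### Bookkeeping: `L³` and `L^{3/2}` norms as lower integrals, slices of slab fields -/

section Bookkeeping

/-- `∫ |f|^{3/2} = ‖f‖_{L^{3/2}}^{3/2}`. [folklore] -/
theorem lintegral_enorm_rpow_threeHalves_eq_eLpNorm_rpow {α : Type*} [MeasurableSpace α]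
    (μ : Measure α) (f : α → ℝ) :
    ∫⁻ x, ‖f x‖ₑ ^ (3 / 2 : ℝ) ∂μ = eLpNorm f (3 / 2 : ℝ≥0∞) μ ^ (3 / 2 : ℝ) := by
  have h32 : (3 / 2 : ℝ≥0∞) ≠ 0 := by norm_num
  have h32' : (3 / 2 : ℝ≥0∞) ≠ ⊤ := by
    rw [ENNReal.div_eq_inv_mul]; exact ENNReal.mul_ne_top (by simp) (by simp)
  have e : (3 / 2 : ℝ≥0∞).toReal = 3 / 2 := by rw [ENNReal.toReal_div]; norm_num
  rw [eLpNorm_eq_lintegral_rpow_enorm_toReal h32 h32', e, ← ENNReal.rpow_mul]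
  norm_num

/-- `∫ |f|³ = ‖f‖_{L³}³`. [folklore] -/
theorem lintegral_enorm_rpow_three_eq_eLpNorm_rpow {α : Type*} [MeasurableSpace α] {G : Type*}
    [NormedAddCommGroup G] (μ : Measure α) (f : α → G) :
    ∫⁻ x, ‖f x‖ₑ ^ (3 : ℝ) ∂μ = eLpNorm f 3 μ ^ (3 : ℝ) := by
  rw [eLpNorm_eq_lintegral_rpow_enorm_toReal (by norm_num) (by norm_num), ENNReal.toReal_ofNat,
    ← ENNReal.rpow_mul]
  norm_num

/-- `(a²)^{3/2} = a³` in `ℝ≥0∞` (private twin of the tree's `Torus.ENNReal.sq_rpow_three_halves`).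
[folklore] -/
private theorem _root_.ENNReal.sq_rpow_threeHalves (a : ℝ≥0∞) : (a ^ 2) ^ (3 / 2 : ℝ) = a ^ (3 : ℝ) := by
  rw [← ENNReal.rpow_natCast a 2, ← ENNReal.rpow_mul]
  norm_num

/-- The restricted Lebesgue measure on the slab `(0,S) × ℝ³` is the product of the restricted
time measure with Lebesgue measure (the tree's `volume_restrict_slab_eq_prod` of
`KatoUniquenessPairing.lean`, re-derived to keep the import closure small). [folklore] -/
theorem volume_restrict_slab_eq_prod₃ (S : ℝ) :
    (volume : Measure (ℝ × ℝ³)).restrict (Ioo 0 S ×ˢ univ) =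
      (volume.restrict (Ioo 0 S)).prod (volume : Measure ℝ³) := by
  rw [Measure.volume_eq_prod, Measure.restrict_prod_eq_prod_univ]

variable {G : Type*} [NormedAddCommGroup G]

/-- **Slices of an `L³` field of the slab**: for a.e. `t ∈ (0,S)` the slice `U(t, ·)` lies in
`L³(ℝ³)` (Fubini–Tonelli). [folklore] -/
theorem ae_memLp_slice_of_memLp_slab {S : ℝ} {U : ℝ × ℝ³ → G}
    (hU : MemLp U 3 (volume.restrict (Ioo 0 S ×ˢ (univ : Set ℝ³)))) :
    ∀ᵐ t ∂(volume.restrict (Ioo 0 S)), MemLp (fun x => U (t, x)) 3 volume := by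
  rw [volume_restrict_slab_eq_prod₃] at hU
  have hm := hU.1.prodMk_left
  have hlt : ∫⁻ t in Ioo 0 S, ∫⁻ x, ‖U (t, x)‖ₑ ^ (3 : ℝ) < ⊤ := by
    rw [← lintegral_prod _ (hU.1.enorm.pow_const _),
      lintegral_enorm_rpow_three_eq_eLpNorm_rpow]
    exact ENNReal.rpow_lt_top_of_nonneg (by norm_num) hU.eLpNorm_ne_top
  have hae := ae_lt_top' (hU.1.enorm.pow_const _).lintegral_prod_right' hlt.ne
  filter_upwards [hm, hae] with t h1 h2
  refine ⟨h1, ?_⟩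
  rw [lintegral_enorm_rpow_three_eq_eLpNorm_rpow] at h2
  exact (ENNReal.rpow_lt_top_iff_of_pos (by norm_num)).1 h2

end Bookkeeping

/-! ### The bilinear estimate of `Π`, integrated in time -/

section Bilinear

variable {S : ℝ}

/-- The constant `K = (4 C_{3/2})^{3/2} √2` of the integrated bilinear estimate. [folklore] -/
theorem bilinConst_ne_top :
    ((4 * steinConstThreeHalves : ℝ≥0∞) ^ (3 / 2 : ℝ) * 2 ^ (1 / 2 : ℝ)) ≠ ⊤ :=
  ENNReal.mul_ne_top (ENNReal.rpow_ne_top_of_nonneg (by norm_num)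
    (ENNReal.mul_ne_top (by norm_num) ENNReal.coe_ne_top))
    (ENNReal.rpow_ne_top_of_nonneg (by norm_num) ENNReal.ofNat_ne_top)

/-- **The bilinear estimate of the Riesz pressure, power `3/2`**: for `v, w ∈ L³` and `τ > 0`,
`‖Π[v] - Π[w]‖_{3/2}^{3/2} ≤ K ((τ²)^{3/2} ‖v - w‖₃³ + (τ⁻²)^{3/2} ‖v + w‖₃³)`, `K = (4C_{3/2})^{3/2} √2`
(the tree's `eLpNorm_rieszPressure_sub_le` and `(x + y)^{3/2} ≤ √2 (x^{3/2} + y^{3/2})`).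
[cite: Tsai1998, Lemma 2.1 proof (p. 34)] -/
theorem eLpNorm_rieszPressure_sub_rpow_le {v w : ℝ³ → ℝ³} (hv : MemLp v 3 volume)
    (hw : MemLp w 3 volume) {τ : ℝ} (hτ : 0 < τ) :
    eLpNorm (rieszPressure v - rieszPressure w) (3 / 2 : ℝ≥0∞) volume ^ (3 / 2 : ℝ) ≤
      (4 * steinConstThreeHalves : ℝ≥0∞) ^ (3 / 2 : ℝ) * 2 ^ (1 / 2 : ℝ) *
        (ENNReal.ofReal (τ ^ 2) ^ (3 / 2 : ℝ) * eLpNorm (v - w) 3 volume ^ (3 : ℝ) +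
          ENNReal.ofReal (τ⁻¹ ^ 2) ^ (3 / 2 : ℝ) * eLpNorm (v + w) 3 volume ^ (3 : ℝ)) := by
  have h := eLpNorm_rieszPressure_sub_le hv hw hτ
  set X : ℝ≥0∞ := ENNReal.ofReal (τ ^ 2) * eLpNorm (v - w) 3 volume ^ 2 with hX
  set Y : ℝ≥0∞ := ENNReal.ofReal (τ⁻¹ ^ 2) * eLpNorm (v + w) 3 volume ^ 2 with hY
  have h2 := ENNReal.rpow_add_le_mul_rpow_add_rpow X Y (by norm_num : (1 : ℝ) ≤ 3 / 2)
  have e2 : (2 : ℝ≥0∞) ^ ((3 / 2 : ℝ) - 1) = 2 ^ (1 / 2 : ℝ) := by norm_num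
  rw [e2] at h2
  have eX : X ^ (3 / 2 : ℝ) = ENNReal.ofReal (τ ^ 2) ^ (3 / 2 : ℝ) * eLpNorm (v - w) 3 volume ^ (3 : ℝ) := by
    rw [hX, ENNReal.mul_rpow_of_nonneg _ _ (by norm_num), ENNReal.sq_rpow_threeHalves]
  have eY : Y ^ (3 / 2 : ℝ) = ENNReal.ofReal (τ⁻¹ ^ 2) ^ (3 / 2 : ℝ) * eLpNorm (v + w) 3 volume ^ (3 : ℝ) := by
    rw [hY, ENNReal.mul_rpow_of_nonneg _ _ (by norm_num), ENNReal.sq_rpow_threeHalves]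
  calc eLpNorm (rieszPressure v - rieszPressure w) (3 / 2 : ℝ≥0∞) volume ^ (3 / 2 : ℝ)
      ≤ (4 * steinConstThreeHalves * (X + Y)) ^ (3 / 2 : ℝ) := ENNReal.rpow_le_rpow h (by norm_num)
    _ = (4 * steinConstThreeHalves : ℝ≥0∞) ^ (3 / 2 : ℝ) * (X + Y) ^ (3 / 2 : ℝ) :=
        ENNReal.mul_rpow_of_nonneg _ _ (by norm_num)
    _ ≤ (4 * steinConstThreeHalves : ℝ≥0∞) ^ (3 / 2 : ℝ) * (2 ^ (1 / 2 : ℝ) * (X ^ (3 / 2 : ℝ) + Y ^ (3 / 2 : ℝ))) := by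
        gcongr
    _ = _ := by rw [eX, eY, mul_assoc]

/-- **The bilinear estimate integrated in time**: for `v, w ∈ L³((0,S) × ℝ³)` and `τ > 0`,
`∫₀ˢ ‖Π[v(t)] - Π[w(t)]‖_{3/2}^{3/2} dt ≤ K ((τ²)^{3/2} ∫∫ |v - w|³ + (τ⁻²)^{3/2} ∫∫ |v + w|³)`
(the slice estimate for a.e. `t` and Tonelli). [cite: Tsai1998, Lemma 2.1 proof (p. 34)] -/
theorem lintegral_eLpNorm_rieszPressure_sub_rpow_le {v w : ℝ → ℝ³ → ℝ³}
    (hv : MemLp (uncurry v) 3 (volume.restrict (Ioo 0 S ×ˢ (univ : Set ℝ³))))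
    (hw : MemLp (uncurry w) 3 (volume.restrict (Ioo 0 S ×ˢ (univ : Set ℝ³)))) {τ : ℝ} (hτ : 0 < τ) :
    ∫⁻ t in Ioo 0 S, eLpNorm (rieszPressure (v t) - rieszPressure (w t)) (3 / 2 : ℝ≥0∞) volume ^ (3 / 2 : ℝ) ≤
      (4 * steinConstThreeHalves : ℝ≥0∞) ^ (3 / 2 : ℝ) * 2 ^ (1 / 2 : ℝ) *
        ((ENNReal.ofReal (τ ^ 2) ^ (3 / 2 : ℝ) *
            ∫⁻ z in Ioo 0 S ×ˢ (univ : Set ℝ³), ‖uncurry v z - uncurry w z‖ₑ ^ (3 : ℝ)) +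
          (ENNReal.ofReal (τ⁻¹ ^ 2) ^ (3 / 2 : ℝ) *
            ∫⁻ z in Ioo 0 S ×ˢ (univ : Set ℝ³), ‖uncurry v z + uncurry w z‖ₑ ^ (3 : ℝ))) := by
  set K : ℝ≥0∞ := (4 * steinConstThreeHalves : ℝ≥0∞) ^ (3 / 2 : ℝ) * 2 ^ (1 / 2 : ℝ) with hK
  set X : ℝ≥0∞ := ENNReal.ofReal (τ ^ 2) ^ (3 / 2 : ℝ) with hX
  set Y : ℝ≥0∞ := ENNReal.ofReal (τ⁻¹ ^ 2) ^ (3 / 2 : ℝ) with hY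
  have hKtop : K ≠ ⊤ := bilinConst_ne_top
  have hXtop : X ≠ ⊤ := ENNReal.rpow_ne_top_of_nonneg (by norm_num) ENNReal.ofReal_ne_top
  have hYtop : Y ≠ ⊤ := ENNReal.rpow_ne_top_of_nonneg (by norm_num) ENNReal.ofReal_ne_top
  have hvs := ae_memLp_slice_of_memLp_slab hv
  have hws := ae_memLp_slice_of_memLp_slab hw
  set A : ℝ → ℝ≥0∞ := fun t => ∫⁻ x, ‖uncurry v (t, x) - uncurry w (t, x)‖ₑ ^ (3 : ℝ) with hA_def
  set B : ℝ → ℝ≥0∞ := fun t => ∫⁻ x, ‖uncurry v (t, x) + uncurry w (t, x)‖ₑ ^ (3 : ℝ) with hB_def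
  -- Tonelli for the two cubic integrals
  have hmeas : ∀ {f : ℝ × ℝ³ → ℝ³}, AEStronglyMeasurable f (volume.restrict (Ioo 0 S ×ˢ (univ : Set ℝ³))) →
      AEMeasurable (fun t => ∫⁻ x, ‖f (t, x)‖ₑ ^ (3 : ℝ)) (volume.restrict (Ioo 0 S)) ∧
      ∫⁻ z in Ioo 0 S ×ˢ (univ : Set ℝ³), ‖f z‖ₑ ^ (3 : ℝ) = ∫⁻ t in Ioo 0 S, ∫⁻ x, ‖f (t, x)‖ₑ ^ (3 : ℝ) := by
    intro f hf
    rw [volume_restrict_slab_eq_prod₃] at hf ⊢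
    exact ⟨(hf.enorm.pow_const _).lintegral_prod_right', lintegral_prod _ (hf.enorm.pow_const _)⟩
  obtain ⟨hmA, hA⟩ : AEMeasurable A (volume.restrict (Ioo 0 S)) ∧
      ∫⁻ z in Ioo 0 S ×ˢ (univ : Set ℝ³), ‖uncurry v z - uncurry w z‖ₑ ^ (3 : ℝ) = ∫⁻ t in Ioo 0 S, A t :=
    hmeas (f := fun z => uncurry v z - uncurry w z) (hv.1.sub hw.1)
  obtain ⟨-, hB⟩ : AEMeasurable B (volume.restrict (Ioo 0 S)) ∧
      ∫⁻ z in Ioo 0 S ×ˢ (univ : Set ℝ³), ‖uncurry v z + uncurry w z‖ₑ ^ (3 : ℝ) = ∫⁻ t in Ioo 0 S, B t :=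
    hmeas (f := fun z => uncurry v z + uncurry w z) (hv.1.add hw.1)
  -- the slice estimate for a.e. `t`
  have hpt : ∀ᵐ t ∂(volume.restrict (Ioo 0 S)),
      eLpNorm (rieszPressure (v t) - rieszPressure (w t)) (3 / 2 : ℝ≥0∞) volume ^ (3 / 2 : ℝ) ≤
        K * (X * A t + Y * B t) := by
    filter_upwards [hvs, hws] with t h1 h2
    have h1' : MemLp (v t) 3 volume := h1
    have h2' : MemLp (w t) 3 volume := h2
    have h := eLpNorm_rieszPressure_sub_rpow_le h1' h2' hτ
    rw [← lintegral_enorm_rpow_three_eq_eLpNorm_rpow, ← lintegral_enorm_rpow_three_eq_eLpNorm_rpow] at h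
    exact h
  calc ∫⁻ t in Ioo 0 S, eLpNorm (rieszPressure (v t) - rieszPressure (w t)) (3 / 2 : ℝ≥0∞) volume ^ (3 / 2 : ℝ)
      ≤ ∫⁻ t in Ioo 0 S, K * (X * A t + Y * B t) := lintegral_mono_ae hpt
    _ = K * ((X * ∫⁻ t in Ioo 0 S, A t) + (Y * ∫⁻ t in Ioo 0 S, B t)) := by
        rw [lintegral_const_mul' _ _ hKtop, lintegral_add_left' (hmA.const_mul X),
          lintegral_const_mul' X _ hXtop, lintegral_const_mul' Y _ hYtop]
    _ = _ := by rw [hA, hB]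

end Bilinear

/-! ### `L³` convergence of the velocities makes the slice pressures Cauchy in the integrated sense -/

section Convergence

variable {S : ℝ}

/-- `‖a + b‖³ ≤ 4 (‖a‖³ + ‖b‖³)` (convexity: `(x + y)³ ≤ 4 (x³ + y³)`). [folklore] -/
theorem enorm_add_rpow_three_le (a b : ℝ³) :
    ‖a + b‖ₑ ^ (3 : ℝ) ≤ 4 * (‖a‖ₑ ^ (3 : ℝ) + ‖b‖ₑ ^ (3 : ℝ)) := by
  have h2 := ENNReal.rpow_add_le_mul_rpow_add_rpow (‖a‖ₑ) (‖b‖ₑ) (by norm_num : (1 : ℝ) ≤ 3)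
  have e4 : (2 : ℝ≥0∞) ^ ((3 : ℝ) - 1) = 4 := by norm_num
  rw [e4] at h2
  exact (ENNReal.rpow_le_rpow (enorm_add_le a b) (by norm_num)).trans h2

/-- `‖a + b‖³ ≤ 4 (‖a - b‖³ + 8 ‖b‖³)` (from `a + b = (a - b) + 2b`). [folklore] -/
theorem enorm_add_rpow_three_le' (a b : ℝ³) :
    ‖a + b‖ₑ ^ (3 : ℝ) ≤ 4 * (‖a - b‖ₑ ^ (3 : ℝ) + 8 * ‖b‖ₑ ^ (3 : ℝ)) := by
  have e : a + b = (a - b) + (2 : ℝ) • b := by rw [two_smul]; abel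
  have e8 : ‖(2 : ℝ) • b‖ₑ ^ (3 : ℝ) = 8 * ‖b‖ₑ ^ (3 : ℝ) := by
    rw [enorm_smul, Real.enorm_eq_ofReal zero_le_two, ENNReal.ofReal_ofNat,
      ENNReal.mul_rpow_of_nonneg _ _ (by norm_num)]
    norm_num
  rw [e, ← e8]
  exact enorm_add_rpow_three_le _ _

/-- **`L³` convergence of the velocities on the slab makes the slice pressures Cauchy in the
integrated sense**: if `‖wⱼ - u‖_{L³((0,S)×ℝ³)} ≤ 2⁻ʲ` then for every `ε > 0`,
`∫₀ˢ ‖Π[wₙ(t)] - Π[wₘ(t)]‖_{3/2}^{3/2} dt ≤ ε` for all large `n, m` (the integrated bilinear estimate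
with `τ` large and then `n, m` large: `∫∫ |wₙ - wₘ|³ ≤ 4 (2⁻ⁿ + 2⁻ᵐ)` while `∫∫ |wₙ + wₘ|³` stays
bounded). [cite: Tsai1998, Lemma 2.1 proof (p. 34)] -/
theorem exists_forall_lintegral_eLpNorm_rieszPressure_sub_rpow_le {u : ℝ → ℝ³ → ℝ³}
    {w : ℕ → ℝ → ℝ³ → ℝ³}
    (hu : MemLp (uncurry u) 3 (volume.restrict (Ioo 0 S ×ˢ (univ : Set ℝ³))))
    (hw : ∀ j, MemLp (uncurry (w j)) 3 (volume.restrict (Ioo 0 S ×ˢ (univ : Set ℝ³))))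
    (hA : ∀ j, eLpNorm (uncurry (w j) - uncurry u) 3 (volume.restrict (Ioo 0 S ×ˢ (univ : Set ℝ³))) ≤
      (2⁻¹ : ℝ≥0∞) ^ j) {ε : ℝ≥0∞} (hε : 0 < ε) :
    ∃ N, ∀ n ≥ N, ∀ m ≥ N, ∫⁻ t in Ioo 0 S,
      eLpNorm (rieszPressure (w n t) - rieszPressure (w m t)) (3 / 2 : ℝ≥0∞) volume ^ (3 / 2 : ℝ) ≤ ε := by
  set μ' : Measure (ℝ × ℝ³) := volume.restrict (Ioo 0 S ×ˢ (univ : Set ℝ³)) with hμ'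
  set K : ℝ≥0∞ := (4 * steinConstThreeHalves : ℝ≥0∞) ^ (3 / 2 : ℝ) * 2 ^ (1 / 2 : ℝ) with hK
  have hKtop : K ≠ ⊤ := bilinConst_ne_top
  set Y : ℝ → ℝ≥0∞ := fun τ => ENNReal.ofReal (τ⁻¹ ^ 2) ^ (3 / 2 : ℝ) with hY
  -- the cubic integrals
  set Acub : ℕ → ℝ≥0∞ := fun j => ∫⁻ z, ‖uncurry (w j) z - uncurry u z‖ₑ ^ (3 : ℝ) ∂μ' with hAcub_def
  set U₃ : ℝ≥0∞ := ∫⁻ z, ‖uncurry u z‖ₑ ^ (3 : ℝ) ∂μ' with hU₃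
  have hU₃top : U₃ ≠ ⊤ := by
    rw [hU₃, lintegral_enorm_rpow_three_eq_eLpNorm_rpow]
    exact ENNReal.rpow_ne_top_of_nonneg (by norm_num) hu.eLpNorm_ne_top
  have hAcub : ∀ j, Acub j ≤ (2⁻¹ : ℝ≥0∞) ^ j := by
    intro j
    have e : Acub j = eLpNorm (uncurry (w j) - uncurry u) 3 μ' ^ (3 : ℝ) :=
      lintegral_enorm_rpow_three_eq_eLpNorm_rpow μ' (uncurry (w j) - uncurry u)
    rw [e]
    have h1 : ((2⁻¹ : ℝ≥0∞) ^ j) ≤ 1 := pow_le_one₀ bot_le (by norm_num)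
    calc eLpNorm (uncurry (w j) - uncurry u) 3 μ' ^ (3 : ℝ) ≤ ((2⁻¹ : ℝ≥0∞) ^ j) ^ (3 : ℝ) :=
          ENNReal.rpow_le_rpow (hA j) (by norm_num)
      _ ≤ ((2⁻¹ : ℝ≥0∞) ^ j) ^ (1 : ℝ) := ENNReal.rpow_le_rpow_of_exponent_ge h1 (by norm_num)
      _ = (2⁻¹ : ℝ≥0∞) ^ j := ENNReal.rpow_one _
  have hAcub1 : ∀ j, Acub j ≤ 1 := fun j => (hAcub j).trans (pow_le_one₀ bot_le (by norm_num))
  have hmA : ∀ j, AEMeasurable (fun z => ‖uncurry (w j) z - uncurry u z‖ₑ ^ (3 : ℝ)) μ' := fun j =>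
    ((hw j).1.sub hu.1).enorm.pow_const _
  -- `∫∫ |wₙ - wₘ|³ ≤ 4 (Acub n + Acub m)`
  have hdiff : ∀ n m, ∫⁻ z, ‖uncurry (w n) z - uncurry (w m) z‖ₑ ^ (3 : ℝ) ∂μ' ≤ 4 * (Acub n + Acub m) := by
    intro n m
    calc ∫⁻ z, ‖uncurry (w n) z - uncurry (w m) z‖ₑ ^ (3 : ℝ) ∂μ'
        ≤ ∫⁻ z, 4 * (‖uncurry (w n) z - uncurry u z‖ₑ ^ (3 : ℝ) +
            ‖uncurry (w m) z - uncurry u z‖ₑ ^ (3 : ℝ)) ∂μ' := by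
          refine lintegral_mono fun z => ?_
          have e : uncurry (w n) z - uncurry (w m) z =
              (uncurry (w n) z - uncurry u z) + -(uncurry (w m) z - uncurry u z) := by abel
          rw [e]
          refine (enorm_add_rpow_three_le _ _).trans ?_
          rw [enorm_neg]
      _ = 4 * (Acub n + Acub m) := by
          rw [lintegral_const_mul' _ _ (by norm_num), lintegral_add_left' (hmA n)]
  -- `∫∫ |wₙ + wₘ|³ ≤ C₁`
  set C₁ : ℝ≥0∞ := 4 * (1 + 4 * (1 + 8 * U₃)) with hC₁
  have hC₁top : C₁ ≠ ⊤ :=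
    ENNReal.mul_ne_top (by norm_num) (ENNReal.add_ne_top.2 ⟨ENNReal.one_ne_top,
      ENNReal.mul_ne_top (by norm_num) (ENNReal.add_ne_top.2 ⟨ENNReal.one_ne_top,
        ENNReal.mul_ne_top (by norm_num) hU₃top⟩)⟩)
  have hsum : ∀ n m, ∫⁻ z, ‖uncurry (w n) z + uncurry (w m) z‖ₑ ^ (3 : ℝ) ∂μ' ≤ C₁ := by
    intro n m
    calc ∫⁻ z, ‖uncurry (w n) z + uncurry (w m) z‖ₑ ^ (3 : ℝ) ∂μ'
        ≤ ∫⁻ z, 4 * (‖uncurry (w n) z - uncurry u z‖ₑ ^ (3 : ℝ) +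
            4 * (‖uncurry (w m) z - uncurry u z‖ₑ ^ (3 : ℝ) + 8 * ‖uncurry u z‖ₑ ^ (3 : ℝ))) ∂μ' := by
          refine lintegral_mono fun z => ?_
          have e : uncurry (w n) z + uncurry (w m) z =
              (uncurry (w n) z - uncurry u z) + (uncurry (w m) z + uncurry u z) := by abel
          rw [e]
          refine (enorm_add_rpow_three_le _ _).trans ?_
          gcongr
          exact enorm_add_rpow_three_le' _ _
      _ = 4 * (Acub n + 4 * (Acub m + 8 * U₃)) := by
          rw [lintegral_const_mul' _ _ (by norm_num), lintegral_add_left' (hmA n),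
            lintegral_const_mul' _ _ (by norm_num), lintegral_add_left' (hmA m),
            lintegral_const_mul' _ _ (by norm_num)]
      _ ≤ C₁ := by rw [hC₁]; gcongr <;> apply hAcub1
  -- the integrated bilinear estimate, for every `τ > 0`
  have hD : ∀ τ : ℝ, 0 < τ → ∀ n m,
      ∫⁻ t in Ioo 0 S, eLpNorm (rieszPressure (w n t) - rieszPressure (w m t)) (3 / 2 : ℝ≥0∞) volume ^ (3 / 2 : ℝ)
        ≤ K * (ENNReal.ofReal (τ ^ 2) ^ (3 / 2 : ℝ) * (4 * (Acub n + Acub m))) + K * (Y τ * C₁) := by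
    intro τ hτ n m
    rw [← mul_add]
    refine (lintegral_eLpNorm_rieszPressure_sub_rpow_le (hw n) (hw m) hτ).trans ?_
    gcongr
    · exact hdiff n m
    · exact hsum n m
  -- `τ → ∞`: the second term is small
  have hYlim : Tendsto (fun τ : ℝ => K * (Y τ * C₁)) atTop (𝓝 0) := by
    have h1 : Tendsto (fun τ : ℝ => τ⁻¹ ^ 2) atTop (𝓝 0) := by
      simpa using (tendsto_inv_atTop_zero (𝕜 := ℝ)).pow 2
    have h2 : Tendsto (fun τ : ℝ => ENNReal.ofReal (τ⁻¹ ^ 2)) atTop (𝓝 0) := by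
      simpa using ENNReal.tendsto_ofReal h1
    have h3 : Tendsto Y atTop (𝓝 0) := by
      have := ((ENNReal.continuous_rpow_const (y := (3 / 2 : ℝ))).tendsto 0).comp h2
      rw [ENNReal.zero_rpow_of_pos (by norm_num : (0 : ℝ) < 3 / 2)] at this
      exact this
    have h4 : Tendsto (fun τ => Y τ * C₁) atTop (𝓝 0) := by
      simpa using ENNReal.Tendsto.mul_const h3 (Or.inr hC₁top)
    simpa using ENNReal.Tendsto.const_mul h4 (Or.inr hKtop)
  have hε2 : 0 < ε / 2 := ENNReal.half_pos hε.ne'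
  obtain ⟨τ, hτε, hτ1⟩ := ((hYlim.eventually_lt_const hε2).and (eventually_ge_atTop 1)).exists
  have hτ : 0 < τ := lt_of_lt_of_le zero_lt_one hτ1
  -- `N → ∞`: the first term is small
  set X : ℝ≥0∞ := ENNReal.ofReal (τ ^ 2) ^ (3 / 2 : ℝ) with hX
  have hXtop : X ≠ ⊤ := ENNReal.rpow_ne_top_of_nonneg (by norm_num) ENNReal.ofReal_ne_top
  have hXlim : Tendsto (fun N => K * (X * (4 * ((2⁻¹ : ℝ≥0∞) ^ N + (2⁻¹ : ℝ≥0∞) ^ N)))) atTop (𝓝 0) := by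
    have h1 : Tendsto (fun N => (2⁻¹ : ℝ≥0∞) ^ N) atTop (𝓝 0) :=
      ENNReal.tendsto_pow_atTop_nhds_zero_iff.2 (by norm_num)
    have h2 : Tendsto (fun N => (2⁻¹ : ℝ≥0∞) ^ N + (2⁻¹ : ℝ≥0∞) ^ N) atTop (𝓝 0) := by
      simpa using h1.add h1
    have h3 : Tendsto (fun N => 4 * ((2⁻¹ : ℝ≥0∞) ^ N + (2⁻¹ : ℝ≥0∞) ^ N)) atTop (𝓝 0) := by
      simpa using ENNReal.Tendsto.const_mul h2 (Or.inr (by norm_num))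
    have h4 : Tendsto (fun N => X * (4 * ((2⁻¹ : ℝ≥0∞) ^ N + (2⁻¹ : ℝ≥0∞) ^ N))) atTop (𝓝 0) := by
      simpa using ENNReal.Tendsto.const_mul h3 (Or.inr hXtop)
    simpa using ENNReal.Tendsto.const_mul h4 (Or.inr hKtop)
  obtain ⟨N, hN⟩ := ENNReal.tendsto_atTop_zero.1 hXlim (ε / 2) hε2
  refine ⟨N, fun n hn m hm => ?_⟩
  have hpn : (2⁻¹ : ℝ≥0∞) ^ n ≤ 2⁻¹ ^ N := pow_le_pow_right_of_le_one' (by norm_num) hn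
  have hpm : (2⁻¹ : ℝ≥0∞) ^ m ≤ 2⁻¹ ^ N := pow_le_pow_right_of_le_one' (by norm_num) hm
  calc _ ≤ K * (X * (4 * (Acub n + Acub m))) + K * (Y τ * C₁) := hD τ hτ n m
    _ ≤ K * (X * (4 * ((2⁻¹ : ℝ≥0∞) ^ N + (2⁻¹ : ℝ≥0∞) ^ N))) + ε / 2 := by
        gcongr
        · exact (hAcub n).trans hpn
        · exact (hAcub m).trans hpm
    _ ≤ ε / 2 + ε / 2 := add_le_add (hN N le_rfl) le_rfl
    _ = ε := ENNReal.add_halves ε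

/-- **Slicewise `L³` convergence along the full sequence**: if `‖wⱼ - u‖_{L³((0,S)×ℝ³)} ≤ 2⁻ʲ`
(jointly measurable fields) then for a.e. `t ∈ (0,S)`, `‖wⱼ(t) - u(t)‖_{L³} → 0` (the cubes of the
slice distances have summable time integrals; Tonelli, Borel–Cantelli in the form `∑ ∫ < ∞`).
[folklore] -/
theorem ae_tendsto_eLpNorm_slice_sub {u : ℝ → ℝ³ → ℝ³} {w : ℕ → ℝ → ℝ³ → ℝ³}
    (hu : MemLp (uncurry u) 3 (volume.restrict (Ioo 0 S ×ˢ (univ : Set ℝ³))))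
    (hw : ∀ j, MemLp (uncurry (w j)) 3 (volume.restrict (Ioo 0 S ×ˢ (univ : Set ℝ³))))
    (hA : ∀ j, eLpNorm (uncurry (w j) - uncurry u) 3 (volume.restrict (Ioo 0 S ×ˢ (univ : Set ℝ³))) ≤
      (2⁻¹ : ℝ≥0∞) ^ j) :
    ∀ᵐ t ∂(volume.restrict (Ioo 0 S)),
      Tendsto (fun j => eLpNorm (w j t - u t) 3 volume) atTop (𝓝 0) := by
  set G : ℕ → ℝ → ℝ≥0∞ := fun j t => ∫⁻ x, ‖uncurry (w j) (t, x) - uncurry u (t, x)‖ₑ ^ (3 : ℝ) with hG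
  have hGm : ∀ j, AEMeasurable (G j) (volume.restrict (Ioo 0 S)) ∧
      ∫⁻ t in Ioo 0 S, G j t ≤ (2⁻¹ : ℝ≥0∞) ^ j := by
    intro j
    have hm : AEStronglyMeasurable (fun z => uncurry (w j) z - uncurry u z)
        ((volume.restrict (Ioo 0 S)).prod (volume : Measure ℝ³)) := by
      rw [← volume_restrict_slab_eq_prod₃]; exact (hw j).1.sub hu.1
    refine ⟨(hm.enorm.pow_const _).lintegral_prod_right', ?_⟩
    rw [hG]
    dsimp only
    rw [← lintegral_prod _ (hm.enorm.pow_const _), ← volume_restrict_slab_eq_prod₃]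
    have e : ∫⁻ z in Ioo 0 S ×ˢ (univ : Set ℝ³), ‖uncurry (w j) z - uncurry u z‖ₑ ^ (3 : ℝ) =
        eLpNorm (uncurry (w j) - uncurry u) 3 (volume.restrict (Ioo 0 S ×ˢ (univ : Set ℝ³))) ^ (3 : ℝ) :=
      lintegral_enorm_rpow_three_eq_eLpNorm_rpow _ (uncurry (w j) - uncurry u)
    rw [e]
    have h1 : ((2⁻¹ : ℝ≥0∞) ^ j) ≤ 1 := pow_le_one₀ bot_le (by norm_num)
    calc eLpNorm (uncurry (w j) - uncurry u) 3 _ ^ (3 : ℝ) ≤ ((2⁻¹ : ℝ≥0∞) ^ j) ^ (3 : ℝ) :=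
          ENNReal.rpow_le_rpow (hA j) (by norm_num)
      _ ≤ ((2⁻¹ : ℝ≥0∞) ^ j) ^ (1 : ℝ) := ENNReal.rpow_le_rpow_of_exponent_ge h1 (by norm_num)
      _ = (2⁻¹ : ℝ≥0∞) ^ j := ENNReal.rpow_one _
  have hsum : ∫⁻ t in Ioo 0 S, ∑' j, G j t ≠ ⊤ := by
    rw [lintegral_tsum fun j => (hGm j).1]
    refine ne_top_of_le_ne_top (b := ∑' j : ℕ, (2⁻¹ : ℝ≥0∞) ^ j) ?_ (ENNReal.tsum_le_tsum fun j => (hGm j).2)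
    rw [ENNReal.tsum_geometric, ENNReal.one_sub_inv_two, inv_inv]
    exact ENNReal.ofNat_ne_top
  have hae := ae_lt_top' (AEMeasurable.tsum fun j => (hGm j).1) hsum
  filter_upwards [hae] with t ht
  have h0 : Tendsto (fun j => G j t) atTop (𝓝 0) := ENNReal.tendsto_atTop_zero_of_tsum_ne_top ht.ne
  have hGt : ∀ j, G j t = eLpNorm (w j t - u t) 3 volume ^ (3 : ℝ) := fun j =>
    lintegral_enorm_rpow_three_eq_eLpNorm_rpow volume (w j t - u t)
  have h1 : Tendsto (fun j => (G j t) ^ (1 / 3 : ℝ)) atTop (𝓝 0) := by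
    have := ((ENNReal.continuous_rpow_const (y := (1 / 3 : ℝ))).tendsto 0).comp h0
    rw [ENNReal.zero_rpow_of_pos (by norm_num : (0 : ℝ) < 1 / 3)] at this
    exact this
  refine h1.congr fun j => ?_
  rw [hGt j, ← ENNReal.rpow_mul]
  norm_num

end Convergence

/-! ### The jointly measurable representative -/

section Limit

variable {S : ℝ} {u : ℝ → ℝ³ → ℝ³}

/-- `1 ≤ 3/2` in `ℝ≥0∞` (private twin of the tree's `ennreal_one_le_three_halves`). [folklore] -/
private theorem one_le_threeHalves : (1 : ℝ≥0∞) ≤ 3 / 2 :=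
  ((ENNReal.lt_div_iff_mul_lt (Or.inl (by norm_num)) (Or.inl (by norm_num))).2 (by norm_num)).le

/-- **The space–time Riesz pressure of an `L³((0,S) × ℝ³)` field: a jointly measurable
representative.** For `0 < S` and `u ∈ L³((0,S) × ℝ³; ℝ³)` (jointly measurable) there is
`P : ℝ × ℝ³ → ℝ`, a.e. strongly measurable and in `L^{3/2}` on the slab, whose slices coincide
a.e. with the Riesz pressures, `P(t, ·) = Π[u(t)]` a.e. for a.e. `t ∈ (0,S)`. Proof: approximate
`u` in `L³` of the slab by continuous compactly supported `wⱼ` (rate `2⁻ʲ`); the space–time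
pressures `pⱼ` of the `L³`-continuous curves `wⱼ` (`exists_spaceTime_rieszPressure`) form a Cauchy
sequence in `L^{3/2}((0,S) × ℝ³)` (`exists_forall_lintegral_eLpNorm_rieszPressure_sub_rpow_le`,
Tonelli), hence converge in `L^{3/2}` and, along a subsequence, a.e. on the slab; for a.e. `t` the
slices `wⱼ(t) → u(t)` in `L³` (`ae_tendsto_eLpNorm_slice_sub`), so `Π[wⱼ(t)] → Π[u(t)]` in
`L^{3/2}` by the continuity of `Π` (`tendsto_eLpNorm_rieszPressure_sub`), and the two limits are
identified through convergence in measure. This removes the time-continuity hypothesis of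
`exists_stronglyMeasurable_slice_ae_eq_rieszPressure` (Lemarié-Rieusset 2016, Prop. 6.5 / Def. 6.9:
the pressure of an `L^∞_t L³_x` very weak solution is `Σ ℛᵢℛⱼ(uᵢuⱼ) ∈ L^∞_t L^{3/2}_x`).
[cite: LemarieRieusset2016, Prop. 6.5 with Def. 6.9 (file p. 136)] -/
theorem exists_aestronglyMeasurable_slice_ae_eq_rieszPressure_of_memLp (hS : 0 < S)
    (hu : MemLp (uncurry u) 3 (volume.restrict (Ioo 0 S ×ˢ (univ : Set ℝ³)))) :
    ∃ P : ℝ × ℝ³ → ℝ,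
      AEStronglyMeasurable P (volume.restrict (Ioo 0 S ×ˢ (univ : Set ℝ³))) ∧
      MemLp P (3 / 2 : ℝ≥0∞) (volume.restrict (Ioo 0 S ×ˢ (univ : Set ℝ³))) ∧
      ∀ᵐ t ∂(volume.restrict (Ioo 0 S)), (fun x => P (t, x)) =ᵐ[volume] rieszPressure (u t) := by
  haveI : Fact ((1 : ℝ≥0∞) ≤ 3 / 2) := ⟨one_le_threeHalves⟩
  set μ' : Measure (ℝ × ℝ³) := volume.restrict (Ioo 0 S ×ˢ (univ : Set ℝ³)) with hμ'
  -- §1 continuous compactly supported approximants, rate `2⁻ʲ`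
  obtain ⟨w, hw, hwA⟩ := exists_hasCompactSupport_eLpNorm_sub_le_slab hu
  have hwmem : ∀ j, MemLp (uncurry (curry (w j))) 3 μ' := fun j =>
    ((hw j).1.memLp_of_hasCompactSupport (μ := (volume : Measure (ℝ × ℝ³))) (hw j).2).restrict _
  have hwA' : ∀ j, eLpNorm (uncurry (curry (w j)) - uncurry u) 3 μ' ≤ (2⁻¹ : ℝ≥0∞) ^ j := hwA
  have hcurve : ∀ j, ContinuousInLpOn (Icc 0 S) 3 (curry (w j)) := fun j =>
    continuousInLpOn_curry_of_hasCompactSupport (hw j).1 (hw j).2 _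
  have hwslice : ∀ j t, MemLp (curry (w j) t) 3 volume := fun j t =>
    ((hw j).1.comp (continuous_const.prodMk continuous_id)).memLp_of_hasCompactSupport
      (hasCompactSupport_slice (hw j).2 t)
  -- §2 the space–time pressures of the approximants
  choose p hpm hpmem hpsl using fun j => exists_spaceTime_rieszPressure hS (hcurve j)
  have hpsl' : ∀ j, ∀ᵐ t ∂(volume.restrict (Ioo 0 S)), p j t =ᵐ[volume] rieszPressure (curry (w j) t) :=
    fun j => (hpsl j).mono fun t ht => ht.1
  -- §3 Cauchy in `L^{3/2}` of the slab
  set F : ℕ → Lp ℝ (3 / 2 : ℝ≥0∞) μ' := fun j => (hpmem j).toLp (uncurry (p j)) with hF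
  have hdist : ∀ n m, eLpNorm (⇑(F n) - ⇑(F m)) (3 / 2 : ℝ≥0∞) μ' ^ (3 / 2 : ℝ) =
      ∫⁻ t in Ioo 0 S, eLpNorm (rieszPressure (curry (w n) t) - rieszPressure (curry (w m) t))
        (3 / 2 : ℝ≥0∞) volume ^ (3 / 2 : ℝ) := by
    intro n m
    have hae : ⇑(F n) - ⇑(F m) =ᵐ[μ'] uncurry (p n) - uncurry (p m) :=
      ((hpmem n).coeFn_toLp).sub ((hpmem m).coeFn_toLp)
    rw [eLpNorm_congr_ae hae, ← lintegral_enorm_rpow_threeHalves_eq_eLpNorm_rpow]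
    have hm : AEStronglyMeasurable (fun z => uncurry (p n) z - uncurry (p m) z)
        ((volume.restrict (Ioo 0 S)).prod (volume : Measure ℝ³)) := by
      rw [← volume_restrict_slab_eq_prod₃]; exact (hpm n).sub (hpm m)
    rw [show (fun z => ‖(uncurry (p n) - uncurry (p m)) z‖ₑ ^ (3 / 2 : ℝ)) =
        fun z => ‖uncurry (p n) z - uncurry (p m) z‖ₑ ^ (3 / 2 : ℝ) from rfl,
      hμ', volume_restrict_slab_eq_prod₃, lintegral_prod _ (hm.enorm.pow_const _)]
    refine lintegral_congr_ae ?_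
    filter_upwards [hpsl' n, hpsl' m] with t hn hm'
    rw [← lintegral_enorm_rpow_threeHalves_eq_eLpNorm_rpow]
    refine lintegral_congr_ae ?_
    filter_upwards [hn, hm'] with x hx1 hx2
    simp only [uncurry_apply_pair, Pi.sub_apply, hx1, hx2]
  have hCauchy : CauchySeq F := by
    rw [Lp.cauchySeq_Lp_iff_cauchySeq_eLpNorm]
    refine ENNReal.tendsto_atTop_zero.2 fun ε hε => ?_
    have hε' : 0 < ε ^ (3 / 2 : ℝ) := ENNReal.rpow_pos_of_nonneg hε (by norm_num)
    obtain ⟨N, hN⟩ := exists_forall_lintegral_eLpNorm_rieszPressure_sub_rpow_le hu hwmem hwA' hε'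
    refine ⟨(N, N), fun nm hnm => ?_⟩
    have h := hN nm.1 hnm.1 nm.2 hnm.2
    rw [← hdist] at h
    exact (ENNReal.rpow_le_rpow_iff (by norm_num : (0 : ℝ) < 3 / 2)).1 h
  obtain ⟨Flim, hFlim⟩ := cauchySeq_tendsto_of_complete hCauchy
  -- §4 `L^{3/2}` convergence, then a.e. convergence along a subsequence
  have hT : Tendsto (fun j => eLpNorm (uncurry (p j) - ⇑Flim) (3 / 2 : ℝ≥0∞) μ') atTop (𝓝 0) := by
    rw [Lp.tendsto_Lp_iff_tendsto_eLpNorm'] at hFlim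
    refine hFlim.congr fun j => eLpNorm_congr_ae ?_
    exact ((hpmem j).coeFn_toLp).sub EventuallyEq.rfl
  have hIM := tendstoInMeasure_of_tendsto_eLpNorm (by norm_num) (fun j => hpm j)
    (Lp.aestronglyMeasurable Flim) hT
  obtain ⟨φ, hφ, hφae⟩ := hIM.exists_seq_tendsto_ae
  set P : ℝ × ℝ³ → ℝ := ⇑Flim with hP
  refine ⟨P, Lp.aestronglyMeasurable Flim, Lp.memLp Flim, ?_⟩
  -- §5 identification of the slices
  have hφae' : ∀ᵐ z ∂((volume.restrict (Ioo 0 S)).prod (volume : Measure ℝ³)),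
      Tendsto (fun i => uncurry (p (φ i)) z) atTop (𝓝 (P z)) := by
    rw [← volume_restrict_slab_eq_prod₃]; exact hφae
  have h1 := Measure.ae_ae_of_ae_prod hφae'
  have h2 := ae_tendsto_eLpNorm_slice_sub hu hwmem hwA'
  have h3 := ae_memLp_slice_of_memLp_slab hu
  have h4 : ∀ᵐ t ∂(volume.restrict (Ioo 0 S)), ∀ j, p j t =ᵐ[volume] rieszPressure (curry (w j) t) :=
    ae_all_iff.2 hpsl'
  have h5 : ∀ᵐ t ∂(volume.restrict (Ioo 0 S)), ∀ j, AEStronglyMeasurable (p j t) volume := by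
    refine ae_all_iff.2 fun j => ?_
    have hm : AEStronglyMeasurable (uncurry (p j)) ((volume.restrict (Ioo 0 S)).prod (volume : Measure ℝ³)) := by
      rw [← volume_restrict_slab_eq_prod₃]; exact hpm j
    exact hm.prodMk_left
  filter_upwards [h1, h2, h3, h4, h5] with t ht1 ht2 ht3 ht4 ht5
  have ht3' : MemLp (u t) 3 volume := ht3
  -- `Π[w_{φ k}(t)] → Π[u(t)]` in `L^{3/2}` (continuity of `Π` on `L³`)
  have hPi : Tendsto (fun k => eLpNorm (rieszPressure (curry (w (φ k)) t) - rieszPressure (u t))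
      (3 / 2 : ℝ≥0∞) volume) atTop (𝓝 0) :=
    (tendsto_eLpNorm_rieszPressure_sub (fun j => hwslice j t) ht3' ht2).comp hφ.tendsto_atTop
  -- hence `p_{φ k}(t) → Π[u(t)]` in measure, and a.e. along a further subsequence
  have hPi' : Tendsto (fun k => eLpNorm (p (φ k) t - rieszPressure (u t)) (3 / 2 : ℝ≥0∞) volume)
      atTop (𝓝 0) := by
    refine hPi.congr fun k => eLpNorm_congr_ae ?_
    exact (ht4 (φ k)).symm.sub EventuallyEq.rfl
  have hIM' := tendstoInMeasure_of_tendsto_eLpNorm (by norm_num) (fun k => ht5 (φ k))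
    (aestronglyMeasurable_rieszPressure' _) hPi'
  obtain ⟨ψ, hψ, hψae⟩ := hIM'.exists_seq_tendsto_ae
  filter_upwards [ht1, hψae] with x hx1 hx2
  exact tendsto_nhds_unique (hx1.comp hψ.tendsto_atTop) hx2

end Limit

/-! ### The space–time pressure with its classes and the weak Poisson equation -/

section Main

variable {S : ℝ} {u : ℝ → ℝ³ → ℝ³}

/-- **The space–time Riesz pressure of an `L³((0,S) × ℝ³)` velocity: existence with all the
classes.** For `0 < S` and a jointly measurable `u ∈ L³((0,S) × ℝ³; ℝ³)` there is
`p : ℝ → ℝ³ → ℝ`, jointly measurable on `(0,S) × ℝ³`, with `p ∈ L^{3/2}((0,S) × ℝ³)`, and for a.e.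
`t ∈ (0,S)`: `u(t) ∈ L³`, `p(t) = Π[u(t)] ∈ L^{3/2}` with Stein's bound
`‖p(t)‖_{L^{3/2}} ≤ C_{3/2} ‖u(t)‖²_{L³}` and the weak pressure Poisson equation
`∫ p(t) Δφ = -∫ D²φ(u(t), u(t))` for all test functions `φ` (`-Δp = Σᵢⱼ ∂ᵢ∂ⱼ(uᵢuⱼ)`). This is the
"associated pressure" `p ∈ L_{3/2}` of an `L₃` velocity field in the whole space (Escauriaza–
Seregin–Šverák 2003, §3, (3.2)–(3.4), via "Ladyzhenskaya's arguments"; Lemarié-Rieusset 2016,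
Prop. 6.5 with Def. 6.9 and Prop. 6.2: `p = Σ ℛᵢℛⱼ(uᵢuⱼ)`; Stein 1970, Ch. II §4.2 Thm. 3), for
velocities without any time regularity (compare `exists_spaceTime_rieszPressure` for
`C([0,S]; L³)` curves). [cite: EscauriazaSereginSverak2003, §3 (3.2)–(3.4)]
[cite: LemarieRieusset2016, Prop. 6.5 with Def. 6.9 (file p. 136) and Prop. 6.2 (p. 130)]
[cite: Stein1971, Ch. II §4.2 Thm. 3] -/
theorem exists_spaceTime_rieszPressure_of_memLp (hS : 0 < S)
    (hu : MemLp (uncurry u) 3 (volume.restrict (Ioo 0 S ×ˢ (univ : Set ℝ³)))) :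
    ∃ p : ℝ → ℝ³ → ℝ,
      AEStronglyMeasurable (uncurry p) (volume.restrict (Ioo 0 S ×ˢ (univ : Set ℝ³))) ∧
      MemLp (uncurry p) (3 / 2 : ℝ≥0∞) (volume.restrict (Ioo 0 S ×ˢ (univ : Set ℝ³))) ∧
      ∀ᵐ t ∂(volume.restrict (Ioo 0 S)),
        p t =ᵐ[volume] rieszPressure (u t) ∧
        MemLp (u t) 3 volume ∧
        MemLp (p t) (3 / 2 : ℝ≥0∞) volume ∧
        eLpNorm (p t) (3 / 2 : ℝ≥0∞) volume ≤ steinConstThreeHalves * eLpNorm (u t) 3 volume ^ 2 ∧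
        ∀ φ : ℝ³ → ℝ, ContDiff ℝ (⊤ : ℕ∞) φ → HasCompactSupport φ →
          ∫ x, p t x * (Δ φ) x = -∫ x, fderiv ℝ (fderiv ℝ φ) x (u t x) (u t x) := by
  obtain ⟨P, hPm, hPmem, hP⟩ := exists_aestronglyMeasurable_slice_ae_eq_rieszPressure_of_memLp hS hu
  set p : ℝ → ℝ³ → ℝ := fun t x => P (t, x) with hp
  have hpP : uncurry p = P := by funext z; rfl
  refine ⟨p, by rw [hpP]; exact hPm, by rw [hpP]; exact hPmem, ?_⟩
  filter_upwards [hP, ae_memLp_slice_of_memLp_slab hu] with t ht hut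
  have hut' : MemLp (u t) 3 volume := hut
  have hR := memLp_rieszPressure hut'
  have ht' : p t =ᵐ[volume] rieszPressure (u t) := ht
  refine ⟨ht', hut', hR.ae_eq ht'.symm, ?_, fun φ hφ hφc => ?_⟩
  · rw [eLpNorm_congr_ae ht']
    exact eLpNorm_rieszPressure_le hut'
  · rw [← integral_rieszPressure_mul_laplacian hut' hφ hφc]
    refine integral_congr_ae ?_
    filter_upwards [ht'] with x hx
    rw [hx]

end Main

end Literature.Analysis.FluidPDE
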